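import Literature.MathematicalPhysics.QuantumFieldTheory.Balaban1983to89.Node00.Record13
import Literature.MathematicalPhysics.QuantumFieldTheory.Balaban1983to89.Node00.Record12Carriers

/-!
# NODE 00 (YM-PLAN Track A) — THE SEVEN CARRIER PINS RESTATED AT def-T's STAGE 13 (`Record13`: the (2.9)-species β at the canonical-version transport, `rstep` in
# the integrable form, the ranged background proviso, the numeric letter `ε₂₉`): `Stage13Params.rebindX ∕ pinB10 ∕ pinY ∕ pinZ ∕ pinW ∕ pinB8 ∕ pinB12 ∕ pinB8Sub`,
# their passage through the Stage-13 view `toStage5₁₃`, the provisos `Provisos₁₃` and the datum `datumOfRecord₁₃` (ALL PINS UP-SIDE), and the four-∕five-∕six-pin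
# views `view₁₃B10YZW ∕ view₁₃B8B10YZW ∕ view₁₃B12B8B10YZW ∕ view₁₃B8subB10YZW ∕ view₁₃B12B8subB10YZW` with their leaves BY NAME
# (seat `pub-ymgap-dag-n10-d` g5 for the parked NODE 00 definer base — the ONE-module restate of g32's `Node00/Record12Carriers` with `12 ↦ 13`)

NODE 00 RECORD MODULE at Stage 13 (director-ym №125∕№129 «RECORD 13»; def-T g7∕g8 `Node00/Record13.lean` p486037 → v1.1 p488788: `structure Stage13Params extends
Stage12Params` with ONE new numeric field `ε₂₉`, `Stage13Params.Admissible := toStage12Params.Admissible ∧ 0 < ε₂₉`, the Stage-13 residual `residualOfStage13` and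
view `Stage13Params.toStage5₁₃ := {toStage5Params with res := residualOfStage13}`, the displayed provisos `Provisos₁₃` (ten fields, none reading a carrier), the
datum `datumOfRecord₁₃` (the five-field tower of record; reads no carrier), the record predicate `IsRecordOfRecord₁₃C`).  Every re-keyed item of rev 16 (K0″–K3″
over `Stage13Params`) and every node's `…AtRecord13` successor binds worlds at PINNED Stage-13 views; this module supplies the pins exactly as g32's `Record12Carriers`
did at Stage 12 — EVERY PIN IS THE STAGE-12 PIN LIFTED THROUGH `toStage12Params`: `Stage13Params.pin<G> θ … := { θ with toStage12Params := θ.toStage12Params.pin<G> … }`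
and the generic device `Stage13Params.rebindX θ X' := { θ with toStage12Params := θ.toStage12Params.rebindX X' }`.  Readings (kernel, all `rfl`): (i) `toStage5₁₃`
keeps `X ∕ Y ∕ Z ∕ W` (`residualOfStage13 = {residualOfStage8 … with V, βfun, χ, E, effAction, Ek, ReprA, IndA, S218}` — the pinned fields read `θ.ν`, `θ.ε₂₉`, the
β-dictionary, `gOfRecord₁₃`, never `res.X ∕ Y ∕ Z ∕ W`), so `toStage5₁₃_rebindX ∕ _pin<G> : rfl`; (ii) `Provisos₁₃`'s ten fields read no carrier (`Provisos₁₃.rebindX`,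
field by field); (iii) `datumOfRecord₁₃_rebindX : rfl` — THE PINS ARE UP-SIDE at Stage 13.  APPEND-ONLY: a NEW importing module; `Record13`, `Record12Carriers` and
every module below them untouched and CONSUMED BY NAME.  [Balaban1988Convergent] = Commun. Math. Phys. **119** (1988) 243–285; [Balaban1989LargeFieldII] = Commun.
Math. Phys. **122** (1989) 355–392.

WHAT IS DEFINED ∕ PROVED (kernel bookkeeping, 0 sorry): `Stage13Params.rebindX` (+ `_toStage12Params : rfl`, `_admissible_iff : Iff.rfl`, `toStage5₁₃_rebindX : rfl`,
`Provisos₁₃.rebindX`, `datumOfRecord₁₃_rebindX : rfl`); the seven pins on `Stage13Params` (`…_toStage12Params : rfl`, `…_admissible_iff : Iff.rfl` ×7,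
`toStage5₁₃_pin<G> : rfl`, `Provisos₁₃.pin<G>`, **`datumOfRecord₁₃_pin<G> : rfl` (ALL PINS UP-SIDE)**, `pinB12_X ∕ pinB8Sub_X : rfl`); `WOfRecord₁₃` = `CarriersW.WOfRecord₁₀`'s recipe ALONG THE ₁₃ PLUGS
(`reprTOfRecord₁₃`, the selector and fibres at `gOfRecord₁₃`; NOT `WOfRecord₁₂ ∘ toStage12Params` — dag-n08-c LOCATED-CARRIERS-13 ∕ dag-lead WORDS-130) (+ `rfl` under the pins); `F12OfRecord₁₂ ∕ B12LeafOfRecord₁₂` READ AT `θ.toStage12Params` (no new frame: the [B12] frame of record at a Stage-13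
parameter IS the Stage-12 one, `F12OfRecord₁₂_pin* : rfl`); the five views at Stage 13 and their leaves (`b8`, `b12` by `Iff.rfl`; the rest by the Stage-5 faces
`upOfRecord₅C_pinW_b9_b10_b11`, `…_pinZ_b9 ∕ _b10 ∕ _b11_iff`, `…_pinY_b9_iff ∕ _b10`, `…_pinB10_b10_iff`, `…_pinW_rBasicStep_iff`, exactly as at Stage 12).  §3 (dag-n08-c DESIGN-REVIEW-A addenda, at the generic re-binding): the does-not-touch faces
`rebindX_res_X ∕ pinB10_res_X ∕ rebindX_L_γ ∕ rebindX_res_Y_Z_W ∕ gOfRecord₁₃_rebindX ∕ betaOfRecord₁₃_rebindX ∕ chiβOfRecord₁₃_rebindX ∕ EOfRecord₁₃_rebindX ∕ densOfRecord₁₃_rebindX ∕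
SLaw₁₃_TLaw₁₃_rebindX ∕ pinB10_histories` (rfl), the carrier-blind rev-16 guard `guard_rebindX_iff` (Iff.rfl), and the ₁₃C record at a re-bound view
`isRecordOfRecord₁₃C_rebindX_of_eq ∕ _pinB10_of_eq`, `exists_world_isRecordOfRecord₁₃C_rebindX`.  The [B13] pin is the sequel `Node00/Record13CarriersB13`.  HONEST FRAMING: definitions + kernel bookkeeping; NO estimate; nothing of Bałaban's asserted; no node discharged; K0″
NOT asserted; counts unmoved; one finite T⁴ programme at fixed ε — NOT continuum ∕ ℝ⁴ ∕ infinite volume ∕ OS ∕ mass gap ∕ Clay.  No `sorry`, no `axiom`, no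
`opaque`, no `instance`, no `notation`. -/

noncomputable section

namespace Literature.MathematicalPhysics.QuantumFieldTheory.Balaban1983to89.Node00

open T4Continuum AveragingRT T4FiniteEpsInhabited FlowStep FlowStepRuns DagBinding T4DatumAssembly
open B8LeafKnitRS (B8LeafRS)
open B15LeafKnitRepr (WOfRepr)
open scoped Matrix.Norms.L2Operator

section Pins

variable (F : T4Family) (N : ℕ) [NeZero N]

/-! ## §1. The generic `X`-re-binding and the seven pins, lifted through `toStage12Params`; their passage through the Stage-13 view, provisos and datum -/

/-- **Re-binding the carrier bundle `X` of Stage-13 parameters** (g32's `Stage12Params.rebindX` lifted; `ε₂₉` and everything else kept). [cite: Balaban1988Convergent, p.244 (bookkeeping)] -/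
def Stage13Params.rebindX (θ : Stage13Params F N) (X' : B12.RunParams → PrintedCarriersR) : Stage13Params F N :=
  { θ with toStage12Params := θ.toStage12Params.rebindX F N X' }

/-- The [B10] pin of Stage-13 parameters (lifted through `toStage12Params`). [cite: Balaban1985UV3, (1)–(5) p.256 (bookkeeping)] -/
def Stage13Params.pinB10 (θ : Stage13Params F N) : Stage13Params F N := { θ with toStage12Params := θ.toStage12Params.pinB10 F N }

/-- The Y pin of Stage-13 parameters. [cite: Balaban1985BackgroundPropagators, Thm 3.1 p.397 (bookkeeping)] -/
def Stage13Params.pinY (θ : Stage13Params F N) (Y₀ : PrintedCarriers9X) : Stage13Params F N := { θ with toStage12Params := θ.toStage12Params.pinY F N Y₀ }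

/-- The Z pin of Stage-13 parameters. [cite: Balaban1985Variational, Thm 1 p.279 (bookkeeping)] -/
def Stage13Params.pinZ (θ : Stage13Params F N) (Z₀ : PrintedCarriers11) : Stage13Params F N := { θ with toStage12Params := θ.toStage12Params.pinZ F N Z₀ }

/-- The W pin of Stage-13 parameters. [cite: Balaban1989LargeFieldI, (0.2) p.176 (bookkeeping)] -/
def Stage13Params.pinW (θ : Stage13Params F N) (W₀ : B12.RunParams → PrintedCarriers15) : Stage13Params F N :=
  { θ with toStage12Params := θ.toStage12Params.pinW F N W₀ }

/-- The [B8] pin of Stage-13 parameters. [cite: Balaban1985RegularSpaces, Thm 2 p.83 (bookkeeping)] -/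
def Stage13Params.pinB8 (θ : Stage13Params F N) (lam : ResidB8 θ.toStage3Params) : Stage13Params F N :=
  { θ with toStage12Params := θ.toStage12Params.pinB8 F N lam }

/-- The [B12] pin of Stage-13 parameters (`X`-re-binding; the [B12] frame of record is the Stage-12 one `F12OfRecord₁₂ θ.toStage12Params`). [cite: Balaban1987RG1, Lemma 4 p.280 (objects of record, Stage 3′(X.B12))] -/
def Stage13Params.pinB12 (θ : Stage13Params F N) (lam : ResidB12 F N θ.τ9.M) : Stage13Params F N :=
  { θ with toStage12Params := θ.toStage12Params.pinB12 F N lam }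

/-- The [B8′] pin of Stage-13 parameters (`X`-re-binding over g32's `withB8OfRecordSub`). [cite: Balaban1985RegularSpaces, Thm 2 p.83 (objects of record, Stage 3′(X.B8′))] -/
def Stage13Params.pinB8Sub (θ : Stage13Params F N) (lam : ResidB8 θ.toStage3Params) : Stage13Params F N :=
  { θ with toStage12Params := θ.toStage12Params.pinB8Sub F N lam }

/-- The Stage-12 part of the re-bound parameter IS the re-bound Stage-12 part (`rfl`). [cite: Balaban1988Convergent, p.244 (bookkeeping)] -/
theorem Stage13Params.rebindX_toStage12Params (θ : Stage13Params F N) (X' : B12.RunParams → PrintedCarriersR) :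
    (θ.rebindX F N X').toStage12Params = θ.toStage12Params.rebindX F N X' := rfl

/-- The pins' Stage-12 parts ARE the Stage-12 pins (`rfl` ×7). [cite: Balaban1989LargeFieldII, Thm 1 p.355 (bookkeeping)] -/
theorem Stage13Params.pins_toStage12Params (θ : Stage13Params F N) (Y₀ : PrintedCarriers9X) (Z₀ : PrintedCarriers11) (W₀ : B12.RunParams → PrintedCarriers15)
    (lam8 : ResidB8 θ.toStage3Params) (lam12 : ResidB12 F N θ.τ9.M) :
    (θ.pinB10 F N).toStage12Params = θ.toStage12Params.pinB10 F N ∧ (θ.pinY F N Y₀).toStage12Params = θ.toStage12Params.pinY F N Y₀ ∧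
      (θ.pinZ F N Z₀).toStage12Params = θ.toStage12Params.pinZ F N Z₀ ∧ (θ.pinW F N W₀).toStage12Params = θ.toStage12Params.pinW F N W₀ ∧
      (θ.pinB8 F N lam8).toStage12Params = θ.toStage12Params.pinB8 F N lam8 ∧ (θ.pinB12 F N lam12).toStage12Params = θ.toStage12Params.pinB12 F N lam12 ∧
      (θ.pinB8Sub F N lam8).toStage12Params = θ.toStage12Params.pinB8Sub F N lam8 :=
  ⟨rfl, rfl, rfl, rfl, rfl, rfl, rfl⟩

/-- The new letter `ε₂₉` is kept by the re-binding and by every pin (`rfl`). [cite: Balaban1987RG1, (2.9) p.266 (bookkeeping)] -/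
theorem Stage13Params.rebindX_ε₂₉ (θ : Stage13Params F N) (X' : B12.RunParams → PrintedCarriersR) : (θ.rebindX F N X').ε₂₉ = θ.ε₂₉ := rfl

/-- Admissibility is unchanged by the re-binding (`Iff.rfl`) … [cite: Balaban1987RG1, (1.20)–(1.21) p.264 (hypothesis dictionary; bookkeeping)] -/
theorem Stage13Params.rebindX_admissible_iff (θ : Stage13Params F N) (X' : B12.RunParams → PrintedCarriersR) :
    (θ.rebindX F N X').Admissible F N ↔ θ.Admissible F N := Iff.rfl

/-- … by the [B10] pin (`Iff.rfl`) … [cite: Balaban1987RG1, (1.20)–(1.21) p.264 (bookkeeping)] -/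
theorem Stage13Params.pinB10_admissible_iff (θ : Stage13Params F N) : (θ.pinB10 F N).Admissible F N ↔ θ.Admissible F N := Iff.rfl

/-- … Y (`Iff.rfl`) … [cite: Balaban1984PropagatorsII, (2.1)–(2.4) p.224 (bookkeeping)] -/
theorem Stage13Params.pinY_admissible_iff (θ : Stage13Params F N) (Y₀ : PrintedCarriers9X) : (θ.pinY F N Y₀).Admissible F N ↔ θ.Admissible F N := Iff.rfl

/-- … Z (`Iff.rfl`) … [cite: Balaban1985Variational, Thm 1 p.279 (bookkeeping)] -/
theorem Stage13Params.pinZ_admissible_iff (θ : Stage13Params F N) (Z₀ : PrintedCarriers11) : (θ.pinZ F N Z₀).Admissible F N ↔ θ.Admissible F N := Iff.rfl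

/-- … W (`Iff.rfl`) … [cite: Balaban1989LargeFieldI, (0.2) p.176 (bookkeeping)] -/
theorem Stage13Params.pinW_admissible_iff (θ : Stage13Params F N) (W₀ : B12.RunParams → PrintedCarriers15) : (θ.pinW F N W₀).Admissible F N ↔ θ.Admissible F N :=
  Iff.rfl

/-- … [B8] (`Iff.rfl`) … [cite: Balaban1983RegularityDecay, (1.6) p.572 (bookkeeping)] -/
theorem Stage13Params.pinB8_admissible_iff (θ : Stage13Params F N) (lam : ResidB8 θ.toStage3Params) : (θ.pinB8 F N lam).Admissible F N ↔ θ.Admissible F N := Iff.rfl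

/-- … [B12] (`Iff.rfl`) … [cite: Balaban1987RG1, (1.12) p.262 (bookkeeping)] -/
theorem Stage13Params.pinB12_admissible_iff (θ : Stage13Params F N) (lam : ResidB12 F N θ.τ9.M) : (θ.pinB12 F N lam).Admissible F N ↔ θ.Admissible F N := Iff.rfl

/-- … and [B8′] (`Iff.rfl`). [cite: Balaban1983RegularityDecay, (1.6) p.572 (bookkeeping)] -/
theorem Stage13Params.pinB8Sub_admissible_iff (θ : Stage13Params F N) (lam : ResidB8 θ.toStage3Params) : (θ.pinB8Sub F N lam).Admissible F N ↔ θ.Admissible F N :=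
  Iff.rfl

/-- The pins keep the Stage-3 dictionary (`rfl` ×3 for the `X`-re-bindings; the `toStage9Params`-level pins likewise by `rfl`). [cite: Balaban1984PropagatorsII, pp.223–250 (bookkeeping)] -/
theorem Stage13Params.rebindX_toStage3Params (θ : Stage13Params F N) (X' : B12.RunParams → PrintedCarriersR) :
    (θ.rebindX F N X').toStage3Params = θ.toStage3Params := rfl

/-- The [B12]-pinned carrier family, unfolded (`rfl`). [cite: Balaban1987RG1, Lemma 4 p.280 (bookkeeping)] -/
theorem Stage13Params.pinB12_X (θ : Stage13Params F N) (lam : ResidB12 F N θ.τ9.M) (p : B12.RunParams) :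
    (θ.pinB12 F N lam).res.X p = (θ.res.X p).withB12 (F12OfRecord₁₂ F N θ.toStage12Params lam p) (lam p).consts := rfl

/-- The [B8′]-pinned carrier family, unfolded (`rfl`). [cite: Balaban1985RegularSpaces, Lemma 1 – Thm 8 pp.79–101 (bookkeeping)] -/
theorem Stage13Params.pinB8Sub_X (θ : Stage13Params F N) (lam : ResidB8 θ.toStage3Params) (P : B12.RunParams) :
    (θ.pinB8Sub F N lam).res.X P = (θ.res.X P).withB8OfRecordSub θ.toStage3Params lam := rfl

/-- **The Stage-13 view commutes with re-binding `X`** (`rfl`, once, at a generic re-binding: `residualOfStage13`'s pinned fields read no carrier).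
[cite: Balaban1988Convergent, p.244 (bookkeeping)] -/
theorem Stage13Params.toStage5₁₃_rebindX (θ : Stage13Params F N) (X' : B12.RunParams → PrintedCarriersR) :
    (θ.rebindX F N X').toStage5₁₃ F N = (θ.toStage5₁₃ F N).rebindX F N X' := rfl

/-- The Stage-13 view of [B10]-pinned parameters IS the [B10]-pinned Stage-13 view (`rfl`). [cite: Balaban1985UV3, (1)–(5) p.256 (bookkeeping)] -/
theorem Stage13Params.toStage5₁₃_pinB10 (θ : Stage13Params F N) : (θ.pinB10 F N).toStage5₁₃ F N = (θ.toStage5₁₃ F N).pinB10 F N :=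
  Stage13Params.toStage5₁₃_rebindX F N θ _

/-- … Y (`rfl`) … [cite: Balaban1985BackgroundPropagators, Thm 3.1 p.397 (bookkeeping)] -/
theorem Stage13Params.toStage5₁₃_pinY (θ : Stage13Params F N) (Y₀ : PrintedCarriers9X) : (θ.pinY F N Y₀).toStage5₁₃ F N = (θ.toStage5₁₃ F N).pinY F N Y₀ := rfl

/-- … Z (`rfl`) … [cite: Balaban1985Variational, Thm 1 p.279 (bookkeeping)] -/
theorem Stage13Params.toStage5₁₃_pinZ (θ : Stage13Params F N) (Z₀ : PrintedCarriers11) : (θ.pinZ F N Z₀).toStage5₁₃ F N = (θ.toStage5₁₃ F N).pinZ F N Z₀ := rfl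

/-- … W (`rfl`) … [cite: Balaban1989LargeFieldI, (0.2) p.176 (bookkeeping)] -/
theorem Stage13Params.toStage5₁₃_pinW (θ : Stage13Params F N) (W₀ : B12.RunParams → PrintedCarriers15) :
    (θ.pinW F N W₀).toStage5₁₃ F N = (θ.toStage5₁₃ F N).pinW F N W₀ := rfl

/-- … [B8] (`rfl`) … [cite: Balaban1985RegularSpaces, Thm 2 p.83 (bookkeeping)] -/
theorem Stage13Params.toStage5₁₃_pinB8 (θ : Stage13Params F N) (lam : ResidB8 θ.toStage3Params) :
    (θ.pinB8 F N lam).toStage5₁₃ F N = (θ.toStage5₁₃ F N).pinB8 F N lam :=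
  Stage13Params.toStage5₁₃_rebindX F N θ _

/-- … [B12] and [B8′] (`rfl` ×2, through `toStage5₁₃_rebindX`). [cite: Balaban1988Convergent, p.244 (bookkeeping)] -/
theorem Stage13Params.toStage5₁₃_pinB12_pinB8Sub (θ : Stage13Params F N) (lam : ResidB12 F N θ.τ9.M) (lam8 : ResidB8 θ.toStage3Params) :
    (θ.pinB12 F N lam).toStage5₁₃ F N = (θ.toStage5₁₃ F N).rebindX F N (XB12OfRecord₁₂ F N θ.toStage12Params lam θ.res.X) ∧
    (θ.pinB8Sub F N lam8).toStage5₁₃ F N = (θ.toStage5₁₃ F N).rebindX F N (fun P => (θ.res.X P).withB8OfRecordSub θ.toStage3Params lam8) :=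
  ⟨Stage13Params.toStage5₁₃_rebindX F N θ _, Stage13Params.toStage5₁₃_rebindX F N θ _⟩

/-- **THE [IV] CARRIER BUNDLE OF RECORD AT STAGE 13, run `P`** — `CarriersW.WOfRecord₁₀`'s recipe ALONG THE ₁₃ PLUGS (NOT `WOfRecord₁₂ ∘ toStage12Params`: the bundle
reads the pre-𝐑 representation, the selector and the fibres at the ₁₃ histories `gOfRecord₁₃ θ P` and `Tstep rep_k` of record at ₁₃, `reprTOfRecord₁₃` — which differ
from ₁₂'s; dag-n08-c LOCATED-CARRIERS-13, dag-lead WORDS-130): n12-a's `WOfRepr` at `reprTOfRecord₁₃ θ P k`, step `k := λ.kSel P`, the selector of record at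
level `k + 1` along `gOfRecord₁₃ θ P`, the fibre bonds `fibOfSeq … (gOfRecord₁₃ θ P) (k+1)`, and the residual letters `LF ∕ D189 ∕ D1100`.
[cite: Balaban1989LargeFieldI, (0.2)–(0.6) p.176, Prop. 1 p.194, (1.89) p.198, (1.100)–(1.102) p.201 (dictionary of the pin); Balaban1988Convergent, (3.25) p.270] -/
def WOfRecord₁₃ (θ : Stage13Params F N) (lam : ResidW F N) (P : B12.RunParams) : PrintedCarriers15 :=
  WOfRepr (reprTOfRecord₁₃ F N θ P (lam.kSel P)) (θ.ppSel P (gOfRecord₁₃ F N θ P) (lam.kSel P + 1))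
    (fibOfSeq F θ.ν θ.τ9 P (gOfRecord₁₃ F N θ P) (lam.kSel P + 1)) (lam.LF P) (lam.D189 P) (lam.D1100 P)

/-- The bundle's Proposition-1 carrier IS the residual `LF P` (`rfl`). [cite: Balaban1989LargeFieldI, Prop. 1 p.194 (bookkeeping)] -/
theorem WOfRecord₁₃_LF (θ : Stage13Params F N) (lam : ResidW F N) (P : B12.RunParams) : (WOfRecord₁₃ F N θ lam P).LF = lam.LF P := rfl

/-- `WOfRecord₁₃` under the pins (`rfl` ×6: the ₁₃ histories, representations, selector and fibres read no carrier). [cite: Balaban1989LargeFieldI, (0.2) p.176 (bookkeeping)] -/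
theorem WOfRecord₁₃_pins (θ : Stage13Params F N) (X' : B12.RunParams → PrintedCarriersR) (W₀ : B12.RunParams → PrintedCarriers15) (lam8 : ResidB8 θ.toStage3Params)
    (lam12 : ResidB12 F N θ.τ9.M) (lam : ResidW F N) :
    WOfRecord₁₃ F N (θ.rebindX F N X') lam = WOfRecord₁₃ F N θ lam ∧ WOfRecord₁₃ F N (θ.pinW F N W₀) lam = WOfRecord₁₃ F N θ lam ∧
      WOfRecord₁₃ F N (θ.pinB8 F N lam8) lam = WOfRecord₁₃ F N θ lam ∧ WOfRecord₁₃ F N (θ.pinB12 F N lam12) lam = WOfRecord₁₃ F N θ lam ∧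
      WOfRecord₁₃ F N (θ.pinB8Sub F N lam8) lam = WOfRecord₁₃ F N θ lam ∧ WOfRecord₁₃ F N (θ.pinB10 F N) lam = WOfRecord₁₃ F N θ lam :=
  ⟨rfl, rfl, rfl, rfl, rfl, rfl⟩

/-- The [B12] frame of record at a Stage-13 parameter is the Stage-12 one and reads no pinned field (`rfl` ×3). [cite: Balaban1987RG1, Lemma 4 (3.53) p.280, (1.11)–(1.16) p.262 (bookkeeping)] -/
theorem F12OfRecord₁₂_stage13_pins (θ : Stage13Params F N) (X' : B12.RunParams → PrintedCarriersR) (lam8 : ResidB8 θ.toStage3Params) (lam lam' : ResidB12 F N θ.τ9.M)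
    (p : B12.RunParams) :
    F12OfRecord₁₂ F N (θ.rebindX F N X').toStage12Params lam p = F12OfRecord₁₂ F N θ.toStage12Params lam p ∧
      F12OfRecord₁₂ F N (θ.pinB12 F N lam').toStage12Params lam p = F12OfRecord₁₂ F N θ.toStage12Params lam p ∧
      F12OfRecord₁₂ F N (θ.pinB8Sub F N lam8).toStage12Params lam p = F12OfRecord₁₂ F N θ.toStage12Params lam p :=
  ⟨rfl, rfl, rfl⟩

variable {F N}

/-- **The Stage-13 provisos read no carrier**: they transport along ANY `X`-re-binding (field by field: the ten fields read `ν`, `τ9`, `ζ`, `ppSel`, `A₁`, `Rz`, `Zt`,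
`γ`, `gOfRecord₁₃`, `EOfRecord₁₃`, `wOfRecord₉`, the ₁₃ background objects — never `res.X`). [cite: Balaban1988Convergent, (2.23)–(2.42) pp.259–262, (3.2)–(3.9) pp.265–266 (bookkeeping)] -/
theorem Stage13Params.Provisos₁₃.rebindX {θ : Stage13Params F N} (h : θ.Provisos₁₃ F N) (X' : B12.RunParams → PrintedCarriersR) :
    (θ.rebindX F N X').Provisos₁₃ F N :=
  { intPiece := h.intPiece, measω := h.measω, measChi := h.measChi, zetaUnity := h.zetaUnity, zetaAbs := h.zetaAbs, rstep := h.rstep,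
    rzLaws := h.rzLaws, ztLaws := h.ztLaws, ztLocal := h.ztLocal, bg := h.bg }

/-- … along the [B10] pin … [cite: Balaban1988Convergent, (2.23)–(2.42) pp.259–262 (bookkeeping)] -/
theorem Stage13Params.Provisos₁₃.pinB10 {θ : Stage13Params F N} (h : θ.Provisos₁₃ F N) : (θ.pinB10 F N).Provisos₁₃ F N :=
  h.rebindX _

/-- … the Y pin … [cite: Balaban1988Convergent, (2.23)–(2.42) pp.259–262 (bookkeeping)] -/
theorem Stage13Params.Provisos₁₃.pinY {θ : Stage13Params F N} (h : θ.Provisos₁₃ F N) (Y₀ : PrintedCarriers9X) : (θ.pinY F N Y₀).Provisos₁₃ F N :=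
  { intPiece := h.intPiece, measω := h.measω, measChi := h.measChi, zetaUnity := h.zetaUnity, zetaAbs := h.zetaAbs, rstep := h.rstep,
    rzLaws := h.rzLaws, ztLaws := h.ztLaws, ztLocal := h.ztLocal, bg := h.bg }

/-- … the Z pin … [cite: Balaban1988Convergent, (2.23)–(2.42) pp.259–262 (bookkeeping)] -/
theorem Stage13Params.Provisos₁₃.pinZ {θ : Stage13Params F N} (h : θ.Provisos₁₃ F N) (Z₀ : PrintedCarriers11) : (θ.pinZ F N Z₀).Provisos₁₃ F N :=
  { intPiece := h.intPiece, measω := h.measω, measChi := h.measChi, zetaUnity := h.zetaUnity, zetaAbs := h.zetaAbs, rstep := h.rstep,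
    rzLaws := h.rzLaws, ztLaws := h.ztLaws, ztLocal := h.ztLocal, bg := h.bg }

/-- … the W pin … [cite: Balaban1988Convergent, (2.23)–(2.42) pp.259–262 (bookkeeping)] -/
theorem Stage13Params.Provisos₁₃.pinW {θ : Stage13Params F N} (h : θ.Provisos₁₃ F N) (W₀ : B12.RunParams → PrintedCarriers15) : (θ.pinW F N W₀).Provisos₁₃ F N :=
  { intPiece := h.intPiece, measω := h.measω, measChi := h.measChi, zetaUnity := h.zetaUnity, zetaAbs := h.zetaAbs, rstep := h.rstep,
    rzLaws := h.rzLaws, ztLaws := h.ztLaws, ztLocal := h.ztLocal, bg := h.bg }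

/-- … the [B8] pin … [cite: Balaban1988Convergent, (2.23)–(2.42) pp.259–262 (bookkeeping)] -/
theorem Stage13Params.Provisos₁₃.pinB8 {θ : Stage13Params F N} (h : θ.Provisos₁₃ F N) (lam : ResidB8 θ.toStage3Params) : (θ.pinB8 F N lam).Provisos₁₃ F N :=
  h.rebindX _

/-- … the [B12] pin … [cite: Balaban1988Convergent, (2.23)–(2.42) pp.259–262 (bookkeeping)] -/
theorem Stage13Params.Provisos₁₃.pinB12 {θ : Stage13Params F N} (h : θ.Provisos₁₃ F N) (lam : ResidB12 F N θ.τ9.M) : (θ.pinB12 F N lam).Provisos₁₃ F N :=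
  h.rebindX _

/-- … and the [B8′] pin. [cite: Balaban1988Convergent, (2.23)–(2.42) pp.259–262 (bookkeeping)] -/
theorem Stage13Params.Provisos₁₃.pinB8Sub {θ : Stage13Params F N} (h : θ.Provisos₁₃ F N) (lam : ResidB8 θ.toStage3Params) : (θ.pinB8Sub F N lam).Provisos₁₃ F N :=
  h.rebindX _

variable (F N)

/-- **THE DATUM DOES NOT READ THE CARRIER BUNDLE `X`** (`rfl`, once, at a generic re-binding). [cite: Balaban1989LargeFieldII, Thm 1 + (0.1) pp.355–356 (bookkeeping)] -/
theorem datumOfRecord₁₃_rebindX (θ : Stage13Params F N) (h : θ.Provisos₁₃ F N) (X' : B12.RunParams → PrintedCarriersR) (h' : (θ.rebindX F N X').Provisos₁₃ F N) :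
    datumOfRecord₁₃ F N (θ.rebindX F N X') h' = datumOfRecord₁₃ F N θ h := rfl

/-- **THE PINS ARE UP-SIDE at Stage 13**: the datum of record is unchanged by the [B10] pin (`rfl`) … [cite: Balaban1989LargeFieldII, Thm 1 + (0.1) pp.355–356 (bookkeeping)] -/
theorem datumOfRecord₁₃_pinB10 (θ : Stage13Params F N) (h : θ.Provisos₁₃ F N) : datumOfRecord₁₃ F N (θ.pinB10 F N) h.pinB10 = datumOfRecord₁₃ F N θ h :=
  datumOfRecord₁₃_rebindX F N θ h _ h.pinB10

/-- … the Y pin (`rfl`) … [cite: Balaban1989LargeFieldII, Thm 1 + (0.1) pp.355–356 (bookkeeping)] -/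
theorem datumOfRecord₁₃_pinY (θ : Stage13Params F N) (h : θ.Provisos₁₃ F N) (Y₀ : PrintedCarriers9X) :
    datumOfRecord₁₃ F N (θ.pinY F N Y₀) (h.pinY Y₀) = datumOfRecord₁₃ F N θ h := rfl

/-- … the Z pin (`rfl`) … [cite: Balaban1989LargeFieldII, Thm 1 + (0.1) pp.355–356 (bookkeeping)] -/
theorem datumOfRecord₁₃_pinZ (θ : Stage13Params F N) (h : θ.Provisos₁₃ F N) (Z₀ : PrintedCarriers11) :
    datumOfRecord₁₃ F N (θ.pinZ F N Z₀) (h.pinZ Z₀) = datumOfRecord₁₃ F N θ h := rfl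

/-- … the W pin (`rfl`) … [cite: Balaban1989LargeFieldII, Thm 1 + (0.1) pp.355–356 (bookkeeping)] -/
theorem datumOfRecord₁₃_pinW (θ : Stage13Params F N) (h : θ.Provisos₁₃ F N) (W₀ : B12.RunParams → PrintedCarriers15) :
    datumOfRecord₁₃ F N (θ.pinW F N W₀) (h.pinW W₀) = datumOfRecord₁₃ F N θ h := rfl

/-- … the [B8] pin (`rfl`) … [cite: Balaban1989LargeFieldII, Thm 1 + (0.1) pp.355–356 (bookkeeping)] -/
theorem datumOfRecord₁₃_pinB8 (θ : Stage13Params F N) (h : θ.Provisos₁₃ F N) (lam : ResidB8 θ.toStage3Params) :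
    datumOfRecord₁₃ F N (θ.pinB8 F N lam) (h.pinB8 lam) = datumOfRecord₁₃ F N θ h :=
  datumOfRecord₁₃_rebindX F N θ h _ (h.pinB8 lam)

/-- … the [B12] pin (`rfl`) … [cite: Balaban1989LargeFieldII, Thm 1 + (0.1) pp.355–356 (bookkeeping)] -/
theorem datumOfRecord₁₃_pinB12 (θ : Stage13Params F N) (h : θ.Provisos₁₃ F N) (lam : ResidB12 F N θ.τ9.M) :
    datumOfRecord₁₃ F N (θ.pinB12 F N lam) (h.pinB12 lam) = datumOfRecord₁₃ F N θ h :=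
  datumOfRecord₁₃_rebindX F N θ h _ (h.pinB12 lam)

/-- … and the [B8′] pin (`rfl`). [cite: Balaban1989LargeFieldII, Thm 1 + (0.1) pp.355–356 (bookkeeping)] -/
theorem datumOfRecord₁₃_pinB8Sub (θ : Stage13Params F N) (h : θ.Provisos₁₃ F N) (lam : ResidB8 θ.toStage3Params) :
    datumOfRecord₁₃ F N (θ.pinB8Sub F N lam) (h.pinB8Sub lam) = datumOfRecord₁₃ F N θ h :=
  datumOfRecord₁₃_rebindX F N θ h _ (h.pinB8Sub lam)


/-! ## §3. What the re-binding does NOT touch (letters, the other residual layers, the ₁₃ histories and plugs, the rev-16 guard), and the ₁₃C record at a re-bound view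
(dag-n08-c DESIGN-REVIEW-A addenda A1′∕A2∕A3, stated ONCE at the generic `rebindX` so every `X`-pin — B10, B8, B8′, B12, B13 — inherits them through `pin<G> = rebindX _`) -/

section Faces

variable (θ : Stage13Params F N) (X' : B12.RunParams → PrintedCarriersR)

/-- The re-bound carrier family, unfolded (`rfl`). [cite: Balaban1988Convergent, p.244 (bookkeeping)] -/
theorem Stage13Params.rebindX_res_X (P : B12.RunParams) : (θ.rebindX F N X').res.X P = X' P := rfl

/-- The [B10]-pinned carrier family, unfolded (`rfl`): only the B10 group moves, to the run family of record at block size `θ.L`. [cite: Balaban1985UV3, (1)–(5) p.256 (bookkeeping)] -/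
theorem Stage13Params.pinB10_res_X (P : B12.RunParams) : (θ.pinB10 F N).res.X P = (θ.res.X P).withRuns10 (runsB10OfRecord N θ.L) := rfl

/-- Re-binding `X` touches neither the block size nor the interval letter (`rfl` ×2) … [cite: Balaban1987RG1, (0.1) p.250; Balaban1989LargeFieldII, Thm 1 p.355 (bookkeeping)] -/
theorem Stage13Params.rebindX_L_γ : (θ.rebindX F N X').L = θ.L ∧ (θ.rebindX F N X').γ = θ.γ := ⟨rfl, rfl⟩

/-- … nor the Y ∕ Z ∕ W layers (`rfl` ×3) … [cite: Balaban1985BackgroundPropagators, Thm 3.1 p.397; Balaban1985Variational, Thm 1 p.279; Balaban1989LargeFieldI, (0.2) p.176 (bookkeeping)] -/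
theorem Stage13Params.rebindX_res_Y_Z_W :
    (θ.rebindX F N X').res.Y = θ.res.Y ∧ (θ.rebindX F N X').res.Z = θ.res.Z ∧ (θ.rebindX F N X').res.W = θ.res.W := ⟨rfl, rfl, rfl⟩

/-- … nor the ₁₃ coupling histories (`rfl`) … [cite: Balaban1987RG1, (1.22) p.264 (bookkeeping)] -/
theorem gOfRecord₁₃_rebindX : gOfRecord₁₃ F N (θ.rebindX F N X') = gOfRecord₁₃ F N θ := rfl

/-- … nor the ₁₃ β of record (`rfl`) … [cite: Balaban1987RG1, (1.20)–(1.22) p.264 (bookkeeping)] -/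
theorem betaOfRecord₁₃_rebindX : betaOfRecord₁₃ F N (θ.rebindX F N X') = betaOfRecord₁₃ F N θ := rfl

/-- … nor the β-slot χ of the (2.9) species (`rfl`) … [cite: Balaban1987RG1, (2.9) p.266 (bookkeeping)] -/
theorem chiβOfRecord₁₃_rebindX : chiβOfRecord₁₃ F N (θ.rebindX F N X') = chiβOfRecord₁₃ F N θ := rfl

/-- … nor the effective actions `E` (`rfl`) … [cite: Balaban1987RG1, (0.17)–(0.19) p.255 (bookkeeping)] -/
theorem EOfRecord₁₃_rebindX : EOfRecord₁₃ F N (θ.rebindX F N X') = EOfRecord₁₃ F N θ := rfl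

/-- … nor the densities of record (`rfl`) … [cite: Balaban1988Convergent, (0.2) p.244 (bookkeeping)] -/
theorem densOfRecord₁₃_rebindX : densOfRecord₁₃ F N (θ.rebindX F N X') = densOfRecord₁₃ F N θ := rfl

/-- … nor the §2-format law and the 𝐓-image law of record (`rfl` ×2). [cite: Balaban1988Convergent, (2.18) p.257, Thm 2 p.263 (bookkeeping)] -/
theorem SLaw₁₃_TLaw₁₃_rebindX : SLaw₁₃ F N (θ.rebindX F N X') = SLaw₁₃ F N θ ∧ TLaw₁₃ F N (θ.rebindX F N X') = TLaw₁₃ F N θ := ⟨rfl, rfl⟩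

/-- **The rev-16 guard is carrier-blind**: print's partition of unity `ZtUnity` and the non-degeneracy of the present slots `SlotsNondegenerate₁₃` are invariant under
re-binding `X` (`Iff.rfl`; the K1‴ prover presents the record at a pinned parameter and reads the guard there). [cite: Balaban1988Convergent, (3.16)–(3.22) pp.268–269; Balaban1989LargeFieldI, (0.3) p.176 (bookkeeping)] -/
theorem Stage13Params.guard_rebindX_iff :
    ((θ.rebindX F N X').ZtUnity F N ∧ (θ.rebindX F N X').SlotsNondegenerate₁₃ F N) ↔ (θ.ZtUnity F N ∧ θ.SlotsNondegenerate₁₃ F N) := Iff.rfl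
set_option maxHeartbeats 400000 in
/-- The [B10] pin: the same seven objects unchanged (`rfl` ×7, an instance of the generic faces). [cite: Balaban1985UV3, (1)–(5) p.256 (bookkeeping)] -/
theorem Stage13Params.pinB10_histories :
    gOfRecord₁₃ F N (θ.pinB10 F N) = gOfRecord₁₃ F N θ ∧ betaOfRecord₁₃ F N (θ.pinB10 F N) = betaOfRecord₁₃ F N θ ∧
      chiβOfRecord₁₃ F N (θ.pinB10 F N) = chiβOfRecord₁₃ F N θ ∧ EOfRecord₁₃ F N (θ.pinB10 F N) = EOfRecord₁₃ F N θ ∧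
        densOfRecord₁₃ F N (θ.pinB10 F N) = densOfRecord₁₃ F N θ ∧ SLaw₁₃ F N (θ.pinB10 F N) = SLaw₁₃ F N θ ∧ TLaw₁₃ F N (θ.pinB10 F N) = TLaw₁₃ F N θ :=
  ⟨rfl, rfl, rfl, rfl, rfl, rfl, rfl⟩

end Faces

section Records

/-- **Pointed form, generic re-binding**: a world with def-T's pointed clauses — construction `(datumOfRecord₁₃ θ h).C`, window `0 < w.γ ≤ θ.γ`, block size `θ.L` — whose
upstream blocks are the C-binding over the Stage-13 view of the RE-BOUND parameters IS a ₁₃C record at `datumOfRecord₁₃ θ h` (presenting parameter `θ.rebindX X'`; the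
datum is unchanged, `datumOfRecord₁₃_rebindX`) — the ONE record lemma every node's ₁₃ ∃-currency at a pinned view wants (dag-n08-c A3). [cite: Balaban1989LargeFieldII, Thm 1 + (0.1) pp.355–356 (bookkeeping)] -/
theorem isRecordOfRecord₁₃C_rebindX_of_eq (θ : Stage13Params F N) (h : θ.Provisos₁₃ F N) (hθ : θ.Admissible F N) (X' : B12.RunParams → PrintedCarriersR)
    (w : WorldP) (hC : w.C = (datumOfRecord₁₃ F N θ h).C) (hγ : 0 < w.γ ∧ w.γ ≤ θ.γ) (hL : w.L = (θ.L : ℝ))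
    (hup : ∀ P, w.up P = upOfRecord₅C F N ((θ.rebindX F N X').toStage5₁₃ F N) P) :
    IsRecordOfRecord₁₃C F N (datumOfRecord₁₃ F N θ h) w :=
  ⟨θ.rebindX F N X', h.rebindX X', (Stage13Params.rebindX_admissible_iff F N θ X').2 hθ, (datumOfRecord₁₃_rebindX F N θ h X' (h.rebindX X')).symm,
    hC, hγ, hL, hup⟩

/-- **EVERY admissible Stage-13 parameter with provisos presents a ₁₃C record at its own datum whose world is bound over ANY re-bound Stage-13 view**, with any window
`0 < γw ≤ θ.γ` and block size `θ.L` (def-T's `exists_world_isRecordOfRecord₁₃C` at `θ.rebindX X'`, read back through `datumOfRecord₁₃_rebindX`). [cite: Balaban1989LargeFieldII, Thm 1 + (0.1) pp.355–356 (bookkeeping)] -/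
theorem exists_world_isRecordOfRecord₁₃C_rebindX (θ : Stage13Params F N) (h : θ.Provisos₁₃ F N) (hθ : θ.Admissible F N) (X' : B12.RunParams → PrintedCarriersR)
    {γw : ℝ} (hγw : 0 < γw ∧ γw ≤ θ.γ) :
    ∃ w : WorldP, IsRecordOfRecord₁₃C F N (datumOfRecord₁₃ F N θ h) w ∧ w.γ = γw ∧ w.L = (θ.L : ℝ) ∧
      ∀ P, w.up P = upOfRecord₅C F N ((θ.rebindX F N X').toStage5₁₃ F N) P := by
  obtain ⟨w₀⟩ := nonempty_worldP
  exact ⟨{ w₀ with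
      C := (datumOfRecord₁₃ F N θ h).C, γ := γw, L := (θ.L : ℝ), one_lt_L := by exact_mod_cast θ.hL.2,
      up := fun P => upOfRecord₅C F N ((θ.rebindX F N X').toStage5₁₃ F N) P },
    isRecordOfRecord₁₃C_rebindX_of_eq F N θ h hθ X' _ rfl hγw rfl (fun _ => rfl), rfl, rfl, fun _ => rfl⟩

/-- The [B10] instance (dag-n08-c's N08 ₁₃ storey reads it by name). [cite: Balaban1989LargeFieldII, Thm 1 + (0.1) pp.355–356; Balaban1985UV3, Thm 1 p.257 (bookkeeping)] -/
theorem isRecordOfRecord₁₃C_pinB10_of_eq (θ : Stage13Params F N) (h : θ.Provisos₁₃ F N) (hθ : θ.Admissible F N)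
    (w : WorldP) (hC : w.C = (datumOfRecord₁₃ F N θ h).C) (hγ : 0 < w.γ ∧ w.γ ≤ θ.γ) (hL : w.L = (θ.L : ℝ))
    (hup : ∀ P, w.up P = upOfRecord₅C F N ((θ.pinB10 F N).toStage5₁₃ F N) P) :
    IsRecordOfRecord₁₃C F N (datumOfRecord₁₃ F N θ h) w :=
  isRecordOfRecord₁₃C_rebindX_of_eq F N θ h hθ _ w hC hγ hL hup

end Records

/-! ## §4. The four-, five- and six-pin Stage-13 views and their leaves BY NAME (the Stage-5 faces of g29–g32, exactly as at Stage 12) -/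

/-- **The cumulative four-pin Stage-13 view**: `θ.toStage5₁₃` pinned by `pinB10`, then `pinY (Y9OfRecord …)`, then `pinZ (Z11OfRecord F N ζ)`, then `pinW (WOfRecord₁₃ θ lamW)`.
[cite: Balaban1985UV3, Thm 1 p.257; Balaban1985BackgroundPropagators, Thm 3.1 p.397; Balaban1985Variational, Thm 1 p.279; Balaban1989LargeFieldI, (0.2) p.176 (objects of record)] -/
def Stage13Params.view₁₃B10YZW (θ : Stage13Params F N) (Mstar : ℕ) (ops : OpsY N θ.toStage3Params Mstar) (ζ : ResidZ F N) (lamW : ResidW F N) :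
    Stage5Params F N :=
  ((((θ.toStage5₁₃ F N).pinB10 F N).pinY F N (Y9OfRecord N θ.toStage3Params Mstar ops)).pinZ F N (Z11OfRecord F N ζ)).pinW F N (WOfRecord₁₃ F N θ lamW)

/-- The four-pin view IS the Stage-13 view of the QUADRUPLY PINNED parameters (composed from the single-pin `rfl`s). [cite: Balaban1989LargeFieldII, Thm 1 p.355 (bookkeeping)] -/
theorem Stage13Params.view₁₃B10YZW_eq (θ : Stage13Params F N) (Mstar : ℕ) (ops : OpsY N θ.toStage3Params Mstar) (ζ : ResidZ F N) (lamW : ResidW F N) :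
    θ.view₁₃B10YZW F N Mstar ops ζ lamW =
      ((((θ.pinB10 F N).pinY F N (Y9OfRecord N θ.toStage3Params Mstar ops)).pinZ F N (Z11OfRecord F N ζ)).pinW F N (WOfRecord₁₃ F N θ lamW)).toStage5₁₃ F N := by
  rw [Stage13Params.toStage5₁₃_pinW, Stage13Params.toStage5₁₃_pinZ, Stage13Params.toStage5₁₃_pinY, Stage13Params.toStage5₁₃_pinB10]
  rfl

/-- The leaves of the C-binding over the four-pin view, by name. [cite: Balaban1989LargeFieldI, Prop. 1 p.194; Balaban1985Variational, Thm 1 p.279; Balaban1985BackgroundPropagators, Thm 3.1 p.397; Balaban1985UV3, Thm 1 p.257 + Thm 2 p.272] -/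
theorem upOfRecord₅C_view₁₃B10YZW_leaves (θ : Stage13Params F N) (Mstar : ℕ) (ops : OpsY N θ.toStage3Params Mstar) (ζ : ResidZ F N) (lamW : ResidW F N) (P : B12.RunParams) :
    ((upOfRecord₅C F N (θ.view₁₃B10YZW F N Mstar ops ζ lamW) P).rBasicStep ↔ B15Leaf (WOfRecord₁₃ F N θ lamW P)) ∧
    ((upOfRecord₅C F N (θ.view₁₃B10YZW F N Mstar ops ζ lamW) P).b9 ↔ B9LeafX (Y9OfRecord N θ.toStage3Params Mstar ops)) ∧
    ((upOfRecord₅C F N (θ.view₁₃B10YZW F N Mstar ops ζ lamW) P).b10 ↔ PrintedUV3V N θ.L) ∧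
    ((upOfRecord₅C F N (θ.view₁₃B10YZW F N Mstar ops ζ lamW) P).b11 ↔ B11Leaf (Z11OfRecord F N ζ)) := by
  have hw := upOfRecord₅C_pinW_b9_b10_b11 F N ((((θ.toStage5₁₃ F N).pinB10 F N).pinY F N (Y9OfRecord N θ.toStage3Params Mstar ops)).pinZ F N (Z11OfRecord F N ζ))
    (WOfRecord₁₃ F N θ lamW) P
  refine ⟨upOfRecord₅C_pinW_rBasicStep_iff F N _ _ P, ?_, ?_, ?_⟩
  · unfold Stage13Params.view₁₃B10YZW
    rw [hw.1, upOfRecord₅C_pinZ_b9]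
    exact upOfRecord₅C_pinY_b9_iff F N _ _ P
  · unfold Stage13Params.view₁₃B10YZW
    rw [hw.2.1, upOfRecord₅C_pinZ_b10, upOfRecord₅C_pinY_b10]
    exact upOfRecord₅C_pinB10_b10_iff F N (θ.toStage5₁₃ F N) P
  · unfold Stage13Params.view₁₃B10YZW
    rw [hw.2.2]
    exact upOfRecord₅C_pinZ_b11_iff F N _ _ P

/-- **The five-pin Stage-13 view with [B8]** ([B8] innermost). [cite: Balaban1985RegularSpaces, Thm 2 p.83 (objects of record)] -/
def Stage13Params.view₁₃B8B10YZW (θ : Stage13Params F N) (lam : ResidB8 θ.toStage3Params) (Mstar : ℕ) (ops : OpsY N θ.toStage3Params Mstar) (ζ : ResidZ F N)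
    (lamW : ResidW F N) : Stage5Params F N :=
  (θ.pinB8 F N lam).view₁₃B10YZW F N Mstar ops ζ lamW

/-- The leaves of the S-binding over the five-pin view, by name (`b8` is `Iff.rfl`; the other four are the four-pin faces at `θ.pinB8 lam`).
[cite: Balaban1985RegularSpaces, Lemma 1 – Thm 8 pp.79–101; Balaban1989LargeFieldI, Prop. 1 p.194; Balaban1985BackgroundPropagators, Thm 3.1 p.397; Balaban1985UV3, Thm 1 p.257; Balaban1985Variational, Thm 1 p.279] -/
theorem upOfRecord₅CS_view₁₃B8B10YZW_leaves (θ : Stage13Params F N) (lam : ResidB8 θ.toStage3Params) (Mstar : ℕ) (ops : OpsY N θ.toStage3Params Mstar)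
    (ζ : ResidZ F N) (lamW : ResidW F N) (P : B12.RunParams) :
    ((upOfRecord₅CS F N (θ.view₁₃B8B10YZW F N lam Mstar ops ζ lamW) P).b8 ↔ B8LeafOfRecord θ.toStage3Params lam) ∧
    ((upOfRecord₅CS F N (θ.view₁₃B8B10YZW F N lam Mstar ops ζ lamW) P).rBasicStep ↔ B15Leaf (WOfRecord₁₃ F N θ lamW P)) ∧
    ((upOfRecord₅CS F N (θ.view₁₃B8B10YZW F N lam Mstar ops ζ lamW) P).b9 ↔ B9LeafX (Y9OfRecord N θ.toStage3Params Mstar ops)) ∧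
    ((upOfRecord₅CS F N (θ.view₁₃B8B10YZW F N lam Mstar ops ζ lamW) P).b10 ↔ PrintedUV3V N θ.L) ∧
    ((upOfRecord₅CS F N (θ.view₁₃B8B10YZW F N lam Mstar ops ζ lamW) P).b11 ↔ B11Leaf (Z11OfRecord F N ζ)) :=
  ⟨Iff.rfl, upOfRecord₅C_view₁₃B10YZW_leaves F N (θ.pinB8 F N lam) Mstar ops ζ lamW P⟩

/-- … and the C-binding's `b8` over the five-pin view is the leaf AS TYPED at the group of record (`Iff.rfl`). [cite: Balaban1985RegularSpaces, Lemma 1 – Thm 8 pp.79–101 (bookkeeping)] -/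
theorem upOfRecord₅C_view₁₃B8B10YZW_b8_iff (θ : Stage13Params F N) (lam : ResidB8 θ.toStage3Params) (Mstar : ℕ) (ops : OpsY N θ.toStage3Params Mstar)
    (ζ : ResidZ F N) (lamW : ResidW F N) (P : B12.RunParams) :
    (upOfRecord₅C F N (θ.view₁₃B8B10YZW F N lam Mstar ops ζ lamW) P).b8 ↔
      B8LeafR θ.D (θ.L : ℝ) lam.C₂ lam.B₁' lam.inp.B₀' lam.B₁ lam.B₂ lam.c₁ lam.inp lam.B₀β (B8Lemma1NonAbelian.blockPairNA θ.D θ.L θ.𝔸)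
        (famB8OfRecord θ.toStage3Params lam.β lam.len) lam.lan lam.cub lam.toAxial :=
  Iff.rfl

/-- **The six-pin Stage-13 view** ([B12] innermost, then the five-pin view with [B8]). [cite: Balaban1987RG1, Lemma 4 p.280; Balaban1985RegularSpaces, Thm 2 p.83 (objects of record)] -/
def Stage13Params.view₁₃B12B8B10YZW (θ : Stage13Params F N) (lam12 : ResidB12 F N θ.τ9.M) (lam : ResidB8 θ.toStage3Params) (Mstar : ℕ)
    (ops : OpsY N θ.toStage3Params Mstar) (ζ : ResidZ F N) (lamW : ResidW F N) : Stage5Params F N :=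
  (θ.pinB12 F N lam12).view₁₃B8B10YZW F N lam Mstar ops ζ lamW

/-- **The five-pin Stage-13 view with [B8′]** ([B8′] innermost). [cite: Balaban1985RegularSpaces, Thm 2 p.83 (objects of record)] -/
def Stage13Params.view₁₃B8subB10YZW (θ : Stage13Params F N) (lam : ResidB8 θ.toStage3Params) (Mstar : ℕ) (ops : OpsY N θ.toStage3Params Mstar) (ζ : ResidZ F N)
    (lamW : ResidW F N) : Stage5Params F N :=
  (θ.pinB8Sub F N lam).view₁₃B10YZW F N Mstar ops ζ lamW

/-- **The six-pin Stage-13 view with [B12] and [B8′]** ([B12] innermost). [cite: Balaban1987RG1, Lemma 4 p.280; Balaban1985RegularSpaces, Thm 2 p.83 (objects of record)] -/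
def Stage13Params.view₁₃B12B8subB10YZW (θ : Stage13Params F N) (lam12 : ResidB12 F N θ.τ9.M) (lam : ResidB8 θ.toStage3Params) (Mstar : ℕ)
    (ops : OpsY N θ.toStage3Params Mstar) (ζ : ResidZ F N) (lamW : ResidW F N) : Stage5Params F N :=
  (θ.pinB12 F N lam12).view₁₃B8subB10YZW F N lam Mstar ops ζ lamW

/-- **THE SIX LEAVES OF THE S-BINDING OVER THE SIX-PIN VIEW**, by name (`b12`, `b8` by `Iff.rfl`; the [B12] leaf is the Stage-12 one at `θ.toStage12Params`). [cite: Balaban1987RG1, Lemma 4 p.280; Balaban1985RegularSpaces, Lemma 1 – Thm 8 pp.79–101; Balaban1989LargeFieldI, Prop. 1 p.194; Balaban1985BackgroundPropagators, Thm 3.1 p.397; Balaban1985UV3, Thm 1 p.257; Balaban1985Variational, Thm 1 p.279] -/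
theorem upOfRecord₅CS_view₁₃B12B8B10YZW_leaves (θ : Stage13Params F N) (lam12 : ResidB12 F N θ.τ9.M) (lam : ResidB8 θ.toStage3Params) (Mstar : ℕ)
    (ops : OpsY N θ.toStage3Params Mstar) (ζ : ResidZ F N) (lamW : ResidW F N) (P : B12.RunParams) :
    ((upOfRecord₅CS F N (θ.view₁₃B12B8B10YZW F N lam12 lam Mstar ops ζ lamW) P).b12 ↔ B12LeafOfRecord₁₂ F N θ.toStage12Params lam12 P) ∧
    ((upOfRecord₅CS F N (θ.view₁₃B12B8B10YZW F N lam12 lam Mstar ops ζ lamW) P).b8 ↔ B8LeafOfRecord θ.toStage3Params lam) ∧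
    ((upOfRecord₅CS F N (θ.view₁₃B12B8B10YZW F N lam12 lam Mstar ops ζ lamW) P).rBasicStep ↔ B15Leaf (WOfRecord₁₃ F N θ lamW P)) ∧
    ((upOfRecord₅CS F N (θ.view₁₃B12B8B10YZW F N lam12 lam Mstar ops ζ lamW) P).b9 ↔ B9LeafX (Y9OfRecord N θ.toStage3Params Mstar ops)) ∧
    ((upOfRecord₅CS F N (θ.view₁₃B12B8B10YZW F N lam12 lam Mstar ops ζ lamW) P).b10 ↔ PrintedUV3V N θ.L) ∧
    ((upOfRecord₅CS F N (θ.view₁₃B12B8B10YZW F N lam12 lam Mstar ops ζ lamW) P).b11 ↔ B11Leaf (Z11OfRecord F N ζ)) :=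
  ⟨Iff.rfl, upOfRecord₅CS_view₁₃B8B10YZW_leaves F N (θ.pinB12 F N lam12) lam Mstar ops ζ lamW P⟩

/-- The leaves of the S-binding over the five-pin view with [B8′], by name (`b8` is `Iff.rfl`). [cite: Balaban1985RegularSpaces, Lemma 1 – Thm 8 pp.79–101; Balaban1989LargeFieldI, Prop. 1 p.194; Balaban1985BackgroundPropagators, Thm 3.1 p.397; Balaban1985UV3, Thm 1 p.257; Balaban1985Variational, Thm 1 p.279] -/
theorem upOfRecord₅CS_view₁₃B8subB10YZW_leaves (θ : Stage13Params F N) (lam : ResidB8 θ.toStage3Params) (Mstar : ℕ) (ops : OpsY N θ.toStage3Params Mstar)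
    (ζ : ResidZ F N) (lamW : ResidW F N) (P : B12.RunParams) :
    ((upOfRecord₅CS F N (θ.view₁₃B8subB10YZW F N lam Mstar ops ζ lamW) P).b8 ↔ B8LeafOfRecordSub θ.toStage3Params lam) ∧
    ((upOfRecord₅CS F N (θ.view₁₃B8subB10YZW F N lam Mstar ops ζ lamW) P).rBasicStep ↔ B15Leaf (WOfRecord₁₃ F N θ lamW P)) ∧
    ((upOfRecord₅CS F N (θ.view₁₃B8subB10YZW F N lam Mstar ops ζ lamW) P).b9 ↔ B9LeafX (Y9OfRecord N θ.toStage3Params Mstar ops)) ∧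
    ((upOfRecord₅CS F N (θ.view₁₃B8subB10YZW F N lam Mstar ops ζ lamW) P).b10 ↔ PrintedUV3V N θ.L) ∧
    ((upOfRecord₅CS F N (θ.view₁₃B8subB10YZW F N lam Mstar ops ζ lamW) P).b11 ↔ B11Leaf (Z11OfRecord F N ζ)) :=
  ⟨Iff.rfl, upOfRecord₅C_view₁₃B10YZW_leaves F N (θ.pinB8Sub F N lam) Mstar ops ζ lamW P⟩

/-- … and the C-binding's `b8` over it is the leaf AS TYPED at the re-keyed group of record (`Iff.rfl`). [cite: Balaban1985RegularSpaces, Lemma 1 – Thm 8 pp.79–101 (bookkeeping)] -/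
theorem upOfRecord₅C_view₁₃B8subB10YZW_b8_iff (θ : Stage13Params F N) (lam : ResidB8 θ.toStage3Params) (Mstar : ℕ) (ops : OpsY N θ.toStage3Params Mstar)
    (ζ : ResidZ F N) (lamW : ResidW F N) (P : B12.RunParams) :
    (upOfRecord₅C F N (θ.view₁₃B8subB10YZW F N lam Mstar ops ζ lamW) P).b8 ↔
      B8LeafR θ.D (θ.L : ℝ) lam.C₂ lam.B₁' lam.inp.B₀' lam.B₁ lam.B₂ lam.c₁ lam.inp lam.B₀β (B8Lemma1NonAbelian.blockPairNA θ.D θ.L θ.𝔸)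
        (fun j : IdxB8Sub θ.toStage3Params => famB8OfRecord θ.toStage3Params lam.β lam.len j.1) lam.lan lam.cub (fun j => lam.toAxial j.1) :=
  Iff.rfl

/-- **THE SIX LEAVES OF THE S-BINDING OVER THE SIX-PIN VIEW WITH [B8′]**, by name (`b12`, `b8` by `Iff.rfl`). [cite: Balaban1987RG1, Lemma 4 p.280; Balaban1985RegularSpaces, Lemma 1 – Thm 8 pp.79–101; Balaban1989LargeFieldI, Prop. 1 p.194; Balaban1985BackgroundPropagators, Thm 3.1 p.397; Balaban1985UV3, Thm 1 p.257; Balaban1985Variational, Thm 1 p.279] -/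
theorem upOfRecord₅CS_view₁₃B12B8subB10YZW_leaves (θ : Stage13Params F N) (lam12 : ResidB12 F N θ.τ9.M) (lam : ResidB8 θ.toStage3Params) (Mstar : ℕ)
    (ops : OpsY N θ.toStage3Params Mstar) (ζ : ResidZ F N) (lamW : ResidW F N) (P : B12.RunParams) :
    ((upOfRecord₅CS F N (θ.view₁₃B12B8subB10YZW F N lam12 lam Mstar ops ζ lamW) P).b12 ↔ B12LeafOfRecord₁₂ F N θ.toStage12Params lam12 P) ∧
    ((upOfRecord₅CS F N (θ.view₁₃B12B8subB10YZW F N lam12 lam Mstar ops ζ lamW) P).b8 ↔ B8LeafOfRecordSub θ.toStage3Params lam) ∧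
    ((upOfRecord₅CS F N (θ.view₁₃B12B8subB10YZW F N lam12 lam Mstar ops ζ lamW) P).rBasicStep ↔ B15Leaf (WOfRecord₁₃ F N θ lamW P)) ∧
    ((upOfRecord₅CS F N (θ.view₁₃B12B8subB10YZW F N lam12 lam Mstar ops ζ lamW) P).b9 ↔ B9LeafX (Y9OfRecord N θ.toStage3Params Mstar ops)) ∧
    ((upOfRecord₅CS F N (θ.view₁₃B12B8subB10YZW F N lam12 lam Mstar ops ζ lamW) P).b10 ↔ PrintedUV3V N θ.L) ∧
    ((upOfRecord₅CS F N (θ.view₁₃B12B8subB10YZW F N lam12 lam Mstar ops ζ lamW) P).b11 ↔ B11Leaf (Z11OfRecord F N ζ)) :=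
  ⟨Iff.rfl, upOfRecord₅CS_view₁₃B8subB10YZW_leaves F N (θ.pinB12 F N lam12) lam Mstar ops ζ lamW P⟩

end Pins

end Literature.MathematicalPhysics.QuantumFieldTheory.Balaban1983to89.Node00

end
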